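import Mathlib
import Literature.Algebra.Polynomial.CoeffList
import Literature.Algebra.Polynomial.CoeffListBivariate
import Literature.Algebra.Polynomial.CoeffListPositivity
import Summits.KontsevichZagierPeriods.KontsevichZagierPeriods.Theorems.IsogenyCertificatesJLPairData
import HarnessLib

/-!
# The Jacquet–Langlands correspondence for `X_0^{35}`: sign certificates, part B (turning point)

Support file for `JLPairIdentityX` (stmt-KontsevichZagierPeriods-14655). The resultant
`R_c = S_c² − disc·D₁²` (degree 102) vanishes on `(−∞,−1)` exactly once, at the turning point
`u_m ≈ −2.1420517` of the tiny-oval branch. Kernel-checked Möbius-substitution certificates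
(`CoeffList.eval_div_pos_of_homog`): `R_c < 0` on `(−∞, −43/20]`, `R_c > 0` on `[−213/100, −1)`,
`R_c' > 0` on `[−43/20, −213/100)`.
-/

namespace Summit.KontsevichZagierPeriods.IsogenyCertificates.JLPair

open Literature.Algebra.Polynomial

/-! ### The turning point: sign certificates for `R_c` and `R_c'` -/

/-- Certificate list for `R_c < 0` on `(−∞, −43/20]`: `−R_c((−43 − 20t)/20)·20¹⁰⁶`. [folklore] -/
theorem Rc_neg_hcq : CoeffList.homog (CoeffList.smul (-1) cRc) [-43, -20] [20] =
    (CoeffList.homog (CoeffList.smul (-1) cRc) [-43, -20] [20]).headD 0 ::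
      (CoeffList.homog (CoeffList.smul (-1) cRc) [-43, -20] [20]).tail := by
  decide +kernel

/-- Its constant coefficient is positive. [folklore] -/
theorem Rc_neg_hc : 0 < (CoeffList.homog (CoeffList.smul (-1) cRc) [-43, -20] [20]).headD 0 := by
  decide +kernel

/-- Its higher coefficients are nonnegative. [folklore] -/
theorem Rc_neg_hq :
    CoeffList.allNonneg (CoeffList.homog (CoeffList.smul (-1) cRc) [-43, -20] [20]).tail = true := by
  decide +kernel

/-- `R_c < 0` on `(−∞, −43/20]` (left of the turning point `u_m ≈ −2.142`). [folklore] -/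
theorem Rc_neg_of_le {u : ℝ} (hu : u ≤ -43 / 20) : CoeffList.eval u cRc < 0 := by
  have ht : (0 : ℝ) ≤ -43 / 20 - u := by linarith
  have hB : (0 : ℝ) < CoeffList.eval (-43 / 20 - u) [20] := by
    simp only [CoeffList.eval_cons, CoeffList.eval_nil]; norm_num
  have h := CoeffList.eval_div_pos_of_homog (K := ℝ) Rc_neg_hcq Rc_neg_hc Rc_neg_hq ht hB
  have hu' : CoeffList.eval (-43 / 20 - u) [-43, -20] / CoeffList.eval (-43 / 20 - u) [20] = u := by
    simp only [CoeffList.eval_cons, CoeffList.eval_nil]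
    push_cast
    ring
  rw [hu', CoeffList.eval_smul] at h
  push_cast at h
  linarith

/-- Certificate list for `R_c > 0` on `[−213/100, −1)`: `(100+100t)¹⁰⁶ R_c((−213−100t)/(100+100t))`. [folklore] -/
theorem Rc_pos_hcq : CoeffList.homog cRc [-213, -100] [100, 100] =
    (CoeffList.homog cRc [-213, -100] [100, 100]).headD 0 ::
      (CoeffList.homog cRc [-213, -100] [100, 100]).tail := by
  decide +kernel

/-- Its constant coefficient is positive. [folklore] -/
theorem Rc_pos_hc : 0 < (CoeffList.homog cRc [-213, -100] [100, 100]).headD 0 := by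
  decide +kernel

/-- Its higher coefficients are nonnegative. [folklore] -/
theorem Rc_pos_hq : CoeffList.allNonneg (CoeffList.homog cRc [-213, -100] [100, 100]).tail = true := by
  decide +kernel

/-- `R_c > 0` on `[−213/100, −1)` (right of the turning point). [folklore] -/
theorem Rc_pos_of_ge {u : ℝ} (hu1 : -213 / 100 ≤ u) (hu2 : u < -1) : 0 < CoeffList.eval u cRc := by
  have hu1' : u + 1 < 0 := by linarith
  have ht : (0 : ℝ) ≤ (-213 / 100 - u) / (u + 1) := div_nonneg_of_nonpos (by linarith) hu1'.le
  have hB : (0 : ℝ) < CoeffList.eval ((-213 / 100 - u) / (u + 1)) [100, 100] := by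
    simp only [CoeffList.eval_cons, CoeffList.eval_nil]; push_cast; nlinarith
  have h := CoeffList.eval_div_pos_of_homog (K := ℝ) Rc_pos_hcq Rc_pos_hc Rc_pos_hq ht hB
  have hne : u + 1 ≠ 0 := hu1'.ne
  have ht' : (-213 / 100 - u) / (u + 1) * (u + 1) = -213 / 100 - u := div_mul_cancel₀ _ hne
  have hu' : CoeffList.eval ((-213 / 100 - u) / (u + 1)) [-213, -100] /
      CoeffList.eval ((-213 / 100 - u) / (u + 1)) [100, 100] = u := by
    rw [div_eq_iff hB.ne']
    simp only [CoeffList.eval_cons, CoeffList.eval_nil]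
    push_cast
    linear_combination (-100) * ht'
  rwa [hu'] at h

/-- Certificate list for `R_c' > 0` on `[−43/20, −213/100)`. [folklore] -/
theorem dRc_pos_hcq : CoeffList.homog (CoeffList.derivList cRc) [-215, -213] [100, 100] =
    (CoeffList.homog (CoeffList.derivList cRc) [-215, -213] [100, 100]).headD 0 ::
      (CoeffList.homog (CoeffList.derivList cRc) [-215, -213] [100, 100]).tail := by
  decide +kernel

/-- Its constant coefficient is positive. [folklore] -/
theorem dRc_pos_hc : 0 < (CoeffList.homog (CoeffList.derivList cRc) [-215, -213] [100, 100]).headD 0 := by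
  decide +kernel

/-- Its higher coefficients are nonnegative. [folklore] -/
theorem dRc_pos_hq :
    CoeffList.allNonneg (CoeffList.homog (CoeffList.derivList cRc) [-215, -213] [100, 100]).tail = true := by
  decide +kernel

/-- `R_c' > 0` on `[−43/20, −213/100)` (so `R_c` is strictly increasing across its zero). [folklore] -/
theorem dRc_pos {u : ℝ} (hu1 : -43 / 20 ≤ u) (hu2 : u < -213 / 100) :
    0 < CoeffList.eval u (CoeffList.derivList cRc) := by
  have hu2' : u + 213 / 100 < 0 := by linarith
  have ht : (0 : ℝ) ≤ (-43 / 20 - u) / (u + 213 / 100) := div_nonneg_of_nonpos (by linarith) hu2'.le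
  have hB : (0 : ℝ) < CoeffList.eval ((-43 / 20 - u) / (u + 213 / 100)) [100, 100] := by
    simp only [CoeffList.eval_cons, CoeffList.eval_nil]; push_cast; nlinarith
  have h := CoeffList.eval_div_pos_of_homog (K := ℝ) dRc_pos_hcq dRc_pos_hc dRc_pos_hq ht hB
  have hne : u + 213 / 100 ≠ 0 := hu2'.ne
  have ht' : (-43 / 20 - u) / (u + 213 / 100) * (u + 213 / 100) = -43 / 20 - u :=
    div_mul_cancel₀ _ hne
  have hu' : CoeffList.eval ((-43 / 20 - u) / (u + 213 / 100)) [-215, -213] /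
      CoeffList.eval ((-43 / 20 - u) / (u + 213 / 100)) [100, 100] = u := by
    rw [div_eq_iff hB.ne']
    simp only [CoeffList.eval_cons, CoeffList.eval_nil]
    push_cast
    linear_combination (-100) * ht'
  rwa [hu'] at h

end Summit.KontsevichZagierPeriods.IsogenyCertificates.JLPair
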